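import Literature.Probability.Percolation.PercolationProofs
import Literature.Probability.Percolation.EnhancementAGLine
import HarnessLib

/-!
# The abstract two-class Aizenman–Grimmett shear
# (`stub_twoClassShear` of line `locmod`, crux `CriticalCurveRegular`, stmt-CriticalPhenomena-16065)

On a finite coordinate set `K` with two disjoint classes `KV` (parameter `t`) and `KH`
(parameter `p`), the other coordinates of `K` frozen at parameter `0`, and an increasing event `A`,
a deterministic local modification turning pivotality of any `e ∈ KV` (in a configuration
`S ⊆ KV ∪ KH`) into pivotality of some `f ∈ KH ∩ Cw e`, changing `S` only inside the window
`Cw e` (`|Cw e| ≤ N`, every `f` in at most `N` windows), gives, for parameters in `[μ₀, 1 - μ₀]`,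
`gTheta K A q(p, t) ≤ gTheta K A q(p + C h, t - h)` with `C = μ₀^{-N} 2^N N`.
Routine port of the tree engine `AGLine.gW_le_of_modification` / `piv_inl_le` / `sum_piv_inl_le` /
`theta_line_mono` (`EnhancementAGLine.lean`; Martineau–Severo, Ann. Probab. 47 (2019) §6, after
Aizenman–Grimmett, J. Stat. Phys. 63 (1991)) from the `Sum`-type setting to one index type with two
finite-energy classes: finite energy `μ₀^{|C|} W(S) ≤ W(S')` (`gW_le_of_mod`), fibres `≤ 2^N`
carrying a pivotal `f ∈ KH ∩ Cw e` (`piv_V_le`), overlap `≤ N` (`sum_piv_V_le`), Russo's formula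
`ProdWeight.hasDerivAt_gTheta` along `s ↦ (p + C s, t - s)` and
`monotoneOn_of_hasDerivWithinAt_nonneg` (`hasDerivAt_line`, `line_mono`).
-/

noncomputable section

open MeasureTheory Set
open Literature.Probability.Percolation Literature.Probability.LatticeModels

namespace Summit.CriticalPhenomena.PercolationContinuityZ3.Cruxes.CriticalCurveRegular.Locmod

namespace TwoClassShear

variable {ι : Type*}

/-- A configuration containing a coordinate of `K` with parameter `0` has weight `0`. [folklore] -/
theorem gW_eq_zero_of_mem {K : Finset ι} {q : ι → ℝ} {S : Finset ι} {i : ι} (hiK : i ∈ K)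
    (hiS : i ∈ S) (hqi : q i = 0) : ProdWeight.gW K q S = 0 := by
  unfold ProdWeight.gW
  refine Finset.prod_eq_zero hiK ?_
  simp [ProdWeight.gwt, hiS, hqi]

open scoped Classical in
/-- If the coordinates of `K` outside `L ⊆ K` have parameter `0`, the pivotal count of `e` is the
sum of the weights of the configurations `S ⊆ L` in which `e` is pivotal. [folklore] -/
theorem gPiv_eq_sum {K L : Finset ι} (hL : L ⊆ K) (A : Set (Set ι)) {q : ι → ℝ}
    (hq0 : ∀ i ∈ K, i ∉ L → q i = 0) (e : ι) :
    ProdWeight.gPiv K A q e =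
      ∑ S ∈ L.powerset.filter (fun S : Finset ι => IsPivotal A e (↑S : Set ι)),
        ProdWeight.gW K q S := by
  rw [Finset.sum_filter, ProdWeight.gPiv]
  symm
  refine Finset.sum_subset (Finset.powerset_mono.2 hL) fun S hSK hSL => ?_
  have hSK' : S ⊆ K := Finset.mem_powerset.1 hSK
  have hSL' : ¬ S ⊆ L := fun h => hSL (Finset.mem_powerset.2 h)
  obtain ⟨i, hiS, hiL⟩ := Finset.not_subset.1 hSL'
  rw [gW_eq_zero_of_mem (hSK' hiS) hiS (hq0 i (hSK' hiS) hiL)]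
  simp

variable [DecidableEq ι]

/-- **Finite energy.** If `S, S' ⊆ L` agree off the window `C` and every coordinate of `L` has its
parameter in `[μ₀, 1 - μ₀]` (all parameters in `[0, 1]`), then `μ₀ ^ |C| · W(S) ≤ W(S')`.
(Martineau–Severo 2019, §6, "differing only inside `B_R(e)`"; port of
`AGLine.gW_le_of_modification`.) [folklore] -/
theorem gW_le_of_mod (K : Finset ι) {L C S S' : Finset ι} {q : ι → ℝ} {μ₀ : ℝ} (hμ₀ : 0 ≤ μ₀)
    (hμ1 : μ₀ ≤ 1) (hq : ∀ i, 0 ≤ q i ∧ q i ≤ 1) (hqL : ∀ i ∈ L, μ₀ ≤ q i ∧ q i ≤ 1 - μ₀)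
    (hS : S ⊆ L) (hS' : S' ⊆ L) (hoff : ∀ i, i ∉ C → (i ∈ S ↔ i ∈ S')) :
    μ₀ ^ C.card * ProdWeight.gW K q S ≤ ProdWeight.gW K q S' := by
  have hagree : ∀ i, ¬ (i ∈ C ∧ i ∈ L) → (i ∈ S ↔ i ∈ S') := by
    intro i hi
    by_cases hiC : i ∈ C
    · have hiL : i ∉ L := fun h => hi ⟨hiC, h⟩
      exact ⟨fun h => (hiL (hS h)).elim, fun h => (hiL (hS' h)).elim⟩
    · exact hoff i hiC
  have hfac : ∀ i ∈ K,
      (if i ∈ C then μ₀ else 1) * ProdWeight.gwt q S i ≤ ProdWeight.gwt q S' i := by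
    intro i _
    by_cases hCL : i ∈ C ∧ i ∈ L
    · rw [if_pos hCL.1]
      calc μ₀ * ProdWeight.gwt q S i ≤ μ₀ * 1 :=
            mul_le_mul_of_nonneg_left (ProdWeight.gwt_le_one hq S i) hμ₀
        _ ≤ ProdWeight.gwt q S' i := by
            rw [mul_one]
            unfold ProdWeight.gwt
            split_ifs
            · exact (hqL i hCL.2).1
            · linarith [(hqL i hCL.2).2]
    · have hiff := hagree i hCL
      have heq : ProdWeight.gwt q S i = ProdWeight.gwt q S' i := by
        unfold ProdWeight.gwt
        by_cases h : i ∈ S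
        · rw [if_pos h, if_pos (hiff.1 h)]
        · rw [if_neg h, if_neg fun h' => h (hiff.2 h')]
      rw [heq]
      refine mul_le_of_le_one_left (ProdWeight.gwt_nonneg hq S' i) ?_
      split_ifs; exacts [hμ1, le_rfl]
  have hcc0 : ∀ i ∈ K, 0 ≤ (if i ∈ C then μ₀ else 1) * ProdWeight.gwt q S i := fun i _ =>
    mul_nonneg (by split_ifs <;> linarith) (ProdWeight.gwt_nonneg hq S i)
  have hprod : (∏ i ∈ K, (if i ∈ C then μ₀ else (1 : ℝ))) * ProdWeight.gW K q S ≤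
      ProdWeight.gW K q S' := by
    unfold ProdWeight.gW
    rw [← Finset.prod_mul_distrib]
    exact Finset.prod_le_prod hcc0 hfac
  have hcprod : μ₀ ^ C.card ≤ ∏ i ∈ K, (if i ∈ C then μ₀ else (1 : ℝ)) := by
    rw [Finset.prod_ite, Finset.prod_const_one, mul_one, Finset.prod_const]
    refine pow_le_pow_of_le_one hμ₀ hμ1 ?_
    exact Finset.card_le_card fun i hi => (Finset.mem_filter.1 hi).2
  calc μ₀ ^ C.card * ProdWeight.gW K q S
      ≤ (∏ i ∈ K, (if i ∈ C then μ₀ else (1 : ℝ))) * ProdWeight.gW K q S :=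
        mul_le_mul_of_nonneg_right hcprod (ProdWeight.gW_nonneg _ hq S)
    _ ≤ ProdWeight.gW K q S' := hprod

/-- **Finite energy and bounded fibres** (Martineau–Severo's (goal)): under the local modification
hypothesis with windows `|Cw e| ≤ N`, for `e ∈ KV` and parameters in `[μ₀, 1 - μ₀]` on `KV ∪ KH`,
`0` elsewhere on `K`: `Piv_e ≤ μ₀^{-N} 2^N Σ_{f ∈ KH ∩ Cw e} Piv_f`. (Martineau–Severo 2019, §6;
port of `AGLine.piv_inl_le`.) [folklore] -/
theorem piv_V_le {K KV KH : Finset ι} {A : Set (Set ι)} {Cw : ι → Finset ι} {N : ℕ}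
    (hKV : KV ⊆ K) (hKH : KH ⊆ K) (hcard : ∀ e ∈ KV, (Cw e).card ≤ N)
    (hmod : ∀ e ∈ KV, ∀ S : Finset ι, S ⊆ KV ∪ KH → IsPivotal A e (↑S : Set ι) →
      ∃ S' : Finset ι, S' ⊆ KV ∪ KH ∧ (∃ f ∈ KH, f ∈ Cw e ∧ IsPivotal A f (↑S' : Set ι)) ∧
        ∀ i, i ∉ Cw e → (i ∈ S ↔ i ∈ S'))
    {q : ι → ℝ} {μ₀ : ℝ} (hμ₀ : 0 < μ₀) (hμ1 : μ₀ ≤ 1) (hq : ∀ i, 0 ≤ q i ∧ q i ≤ 1)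
    (hqL : ∀ i ∈ KV ∪ KH, μ₀ ≤ q i ∧ q i ≤ 1 - μ₀) (hq0 : ∀ i ∈ K, i ∉ KV ∪ KH → q i = 0)
    {e : ι} (he : e ∈ KV) :
    ProdWeight.gPiv K A q e ≤ (μ₀ ^ N)⁻¹ * 2 ^ N *
      ∑ f ∈ KH.filter (fun f => f ∈ Cw e), ProdWeight.gPiv K A q f := by
  classical
  have hL : KV ∪ KH ⊆ K := Finset.union_subset hKV hKH
  set L : Finset ι := KV ∪ KH with hLdef
  set D : Finset (Finset ι) :=
    L.powerset.filter fun S : Finset ι => IsPivotal A e (↑S : Set ι) with hD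
  have hex : ∀ S ∈ D, ∃ S' : Finset ι, S' ⊆ L ∧
      (∃ f ∈ KH, f ∈ Cw e ∧ IsPivotal A f (↑S' : Set ι)) ∧
      μ₀ ^ N * ProdWeight.gW K q S ≤ ProdWeight.gW K q S' ∧
      S.filter (fun i => i ∉ Cw e) = S'.filter (fun i => i ∉ Cw e) := by
    intro S hS
    obtain ⟨hSL, hpiv⟩ := Finset.mem_filter.1 hS
    have hSL' : S ⊆ L := Finset.mem_powerset.1 hSL
    obtain ⟨S', hS'L, hf, hoff⟩ := hmod e he S hSL' hpiv
    refine ⟨S', hS'L, hf, ?_, ?_⟩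
    · have h1 := gW_le_of_mod K hμ₀.le hμ1 hq hqL hSL' hS'L hoff
      refine le_trans ?_ h1
      refine mul_le_mul_of_nonneg_right ?_ (ProdWeight.gW_nonneg _ hq S)
      exact pow_le_pow_of_le_one hμ₀.le hμ1 (hcard e he)
    · ext i
      simp only [Finset.mem_filter]
      constructor
      · rintro ⟨hi, hiC⟩; exact ⟨(hoff i hiC).1 hi, hiC⟩
      · rintro ⟨hi, hiC⟩; exact ⟨(hoff i hiC).2 hi, hiC⟩
  choose! Φ hΦL hΦpiv hΦw hΦoff using hex
  have hA : ProdWeight.gPiv K A q e ≤ (μ₀ ^ N)⁻¹ * ∑ S ∈ D, ProdWeight.gW K q (Φ S) := by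
    have hPiv : ProdWeight.gPiv K A q e = ∑ S ∈ D, ProdWeight.gW K q S := by
      rw [hD]
      exact gPiv_eq_sum hL A hq0 e
    rw [hPiv, Finset.mul_sum]
    refine Finset.sum_le_sum fun S hS => ?_
    have hμn : 0 < μ₀ ^ N := pow_pos hμ₀ _
    rw [← div_le_iff₀' (inv_pos.2 hμn), div_inv_eq_mul, mul_comm]
    exact hΦw S hS
  have hB : ∑ S ∈ D, ProdWeight.gW K q (Φ S) ≤
      2 ^ N * ∑ S' ∈ D.image Φ, ProdWeight.gW K q S' := by
    rw [Finset.sum_comp, Finset.mul_sum]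
    refine Finset.sum_le_sum fun S' hS' => ?_
    rw [nsmul_eq_mul]
    refine mul_le_mul_of_nonneg_right ?_ (ProdWeight.gW_nonneg _ hq S')
    have hcardF : (D.filter fun S => Φ S = S').card ≤ (Cw e).powerset.card := by
      refine Finset.card_le_card_of_injOn (fun S => S.filter fun i => i ∈ Cw e) ?_ ?_
      · intro S _
        simp only [Finset.coe_powerset, Set.mem_preimage, Set.mem_powerset_iff, Finset.coe_subset]
        exact fun i hi => (Finset.mem_filter.1 hi).2
      · intro S₁ hS₁ S₂ hS₂ hEq
        simp only [Finset.coe_filter, Set.mem_setOf_eq] at hS₁ hS₂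
        have h1 := hΦoff S₁ hS₁.1
        have h2 := hΦoff S₂ hS₂.1
        rw [hS₁.2] at h1; rw [hS₂.2] at h2
        rw [← Finset.filter_union_filter_not_eq (fun i => i ∈ Cw e) S₁,
          ← Finset.filter_union_filter_not_eq (fun i => i ∈ Cw e) S₂]
        simp only at hEq
        rw [hEq, h1, ← h2]
    calc ((D.filter fun S => Φ S = S').card : ℝ) ≤ ((Cw e).powerset.card : ℝ) := by
          exact_mod_cast hcardF
      _ = 2 ^ (Cw e).card := by rw [Finset.card_powerset]; push_cast; ring
      _ ≤ 2 ^ N := pow_le_pow_right₀ (by norm_num) (hcard e he)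
  set box := KH.filter (fun f => f ∈ Cw e) with hbox
  have hC : ∑ S' ∈ D.image Φ, ProdWeight.gW K q S' ≤ ∑ f ∈ box, ProdWeight.gPiv K A q f := by
    set P : Finset ι → Prop := fun S' => ∃ f ∈ box, IsPivotal A f (↑S' : Set ι) with hP
    have hsub : D.image Φ ⊆ K.powerset.filter P := by
      intro S' hS'
      obtain ⟨S, hS, rfl⟩ := Finset.mem_image.1 hS'
      refine Finset.mem_filter.2 ⟨Finset.mem_powerset.2 ((hΦL S hS).trans hL), ?_⟩
      obtain ⟨f, hf, hfc, hpiv⟩ := hΦpiv S hS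
      exact ⟨f, Finset.mem_filter.2 ⟨hf, hfc⟩, hpiv⟩
    set g : Finset ι → ι → ℝ := fun S' f =>
      if IsPivotal A f (↑S' : Set ι) then ProdWeight.gW K q S' else 0 with hg
    have hg0 : ∀ S' f, 0 ≤ g S' f := fun S' f => by
      simp only [hg]; split_ifs; exacts [ProdWeight.gW_nonneg _ hq S', le_rfl]
    calc ∑ S' ∈ D.image Φ, ProdWeight.gW K q S'
        ≤ ∑ S' ∈ K.powerset.filter P, ProdWeight.gW K q S' :=
          Finset.sum_le_sum_of_subset_of_nonneg hsub fun S' _ _ => ProdWeight.gW_nonneg _ hq S'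
      _ ≤ ∑ S' ∈ K.powerset.filter P, ∑ f ∈ box, g S' f := by
          refine Finset.sum_le_sum fun S' hS' => ?_
          obtain ⟨-, f, hf, hpiv⟩ := Finset.mem_filter.1 hS'
          have hle : g S' f ≤ ∑ f' ∈ box, g S' f' :=
            Finset.single_le_sum (f := g S') (fun f' _ => hg0 S' f') hf
          have hgf : g S' f = ProdWeight.gW K q S' := by simp [hg, hpiv]
          rw [hgf] at hle
          exact hle
      _ ≤ ∑ S' ∈ K.powerset, ∑ f ∈ box, g S' f :=
          Finset.sum_le_sum_of_subset_of_nonneg (Finset.filter_subset _ _) fun S' _ _ =>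
            Finset.sum_nonneg fun f _ => hg0 S' f
      _ = ∑ f ∈ box, ProdWeight.gPiv K A q f := by
          rw [Finset.sum_comm]
          rfl
  have h2pos : (0 : ℝ) ≤ 2 ^ N := by positivity
  have hμinv : (0 : ℝ) ≤ (μ₀ ^ N)⁻¹ := inv_nonneg.2 (pow_nonneg hμ₀.le _)
  calc ProdWeight.gPiv K A q e
      ≤ (μ₀ ^ N)⁻¹ * ∑ S ∈ D, ProdWeight.gW K q (Φ S) := hA
    _ ≤ (μ₀ ^ N)⁻¹ * (2 ^ N * ∑ S' ∈ D.image Φ, ProdWeight.gW K q S') :=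
        mul_le_mul_of_nonneg_left hB hμinv
    _ ≤ (μ₀ ^ N)⁻¹ * (2 ^ N * ∑ f ∈ box, ProdWeight.gPiv K A q f) :=
        mul_le_mul_of_nonneg_left (mul_le_mul_of_nonneg_left hC h2pos) hμinv
    _ = _ := by ring

/-- **The Aizenman–Grimmett inequality** ((goal) summed over `e ∈ KV`, overlap `≤ N`):
`Σ_{e ∈ KV} Piv_e ≤ μ₀^{-N} 2^N N · Σ_{f ∈ KH} Piv_f`. (Martineau–Severo 2019, §6,
(goal) ⟹ (diffineq); port of `AGLine.sum_piv_inl_le`.) [folklore] -/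
theorem sum_piv_V_le {K KV KH : Finset ι} {A : Set (Set ι)} {Cw : ι → Finset ι} {N : ℕ}
    (hKV : KV ⊆ K) (hKH : KH ⊆ K) (hcard : ∀ e ∈ KV, (Cw e).card ≤ N)
    (hover : ∀ f ∈ KH, (KV.filter fun e => f ∈ Cw e).card ≤ N)
    (hmod : ∀ e ∈ KV, ∀ S : Finset ι, S ⊆ KV ∪ KH → IsPivotal A e (↑S : Set ι) →
      ∃ S' : Finset ι, S' ⊆ KV ∪ KH ∧ (∃ f ∈ KH, f ∈ Cw e ∧ IsPivotal A f (↑S' : Set ι)) ∧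
        ∀ i, i ∉ Cw e → (i ∈ S ↔ i ∈ S'))
    {q : ι → ℝ} {μ₀ : ℝ} (hμ₀ : 0 < μ₀) (hμ1 : μ₀ ≤ 1) (hq : ∀ i, 0 ≤ q i ∧ q i ≤ 1)
    (hqL : ∀ i ∈ KV ∪ KH, μ₀ ≤ q i ∧ q i ≤ 1 - μ₀) (hq0 : ∀ i ∈ K, i ∉ KV ∪ KH → q i = 0) :
    ∑ e ∈ KV, ProdWeight.gPiv K A q e ≤
      (μ₀ ^ N)⁻¹ * 2 ^ N * (N : ℝ) * ∑ f ∈ KH, ProdWeight.gPiv K A q f := by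
  set C₁ : ℝ := (μ₀ ^ N)⁻¹ * 2 ^ N with hC₁
  have hC₁0 : 0 ≤ C₁ := mul_nonneg (inv_nonneg.2 (pow_nonneg hμ₀.le _)) (by positivity)
  have hPiv0 : ∀ f, 0 ≤ ProdWeight.gPiv K A q f := fun f => ProdWeight.gPiv_nonneg _ _ hq f
  calc ∑ e ∈ KV, ProdWeight.gPiv K A q e
      ≤ ∑ e ∈ KV, C₁ * ∑ f ∈ KH.filter (fun f => f ∈ Cw e), ProdWeight.gPiv K A q f :=
        Finset.sum_le_sum fun e he => piv_V_le hKV hKH hcard hmod hμ₀ hμ1 hq hqL hq0 he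
    _ = C₁ * ∑ e ∈ KV, ∑ f ∈ KH, (if f ∈ Cw e then ProdWeight.gPiv K A q f else 0) := by
        rw [← Finset.mul_sum]
        refine congrArg (C₁ * ·) (Finset.sum_congr rfl fun e _ => ?_)
        rw [Finset.sum_filter]
    _ = C₁ * ∑ f ∈ KH, ∑ e ∈ KV, (if f ∈ Cw e then ProdWeight.gPiv K A q f else 0) := by
        rw [Finset.sum_comm]
    _ = C₁ * ∑ f ∈ KH, ((KV.filter fun e => f ∈ Cw e).card : ℝ) * ProdWeight.gPiv K A q f := by
        refine congrArg (C₁ * ·) (Finset.sum_congr rfl fun f _ => ?_)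
        rw [← Finset.sum_filter, Finset.sum_const, nsmul_eq_mul]
    _ ≤ C₁ * ∑ f ∈ KH, (N : ℝ) * ProdWeight.gPiv K A q f := by
        refine mul_le_mul_of_nonneg_left (Finset.sum_le_sum fun f hf => ?_) hC₁0
        refine mul_le_mul_of_nonneg_right ?_ (hPiv0 f)
        exact_mod_cast hover f hf
    _ = C₁ * (N : ℝ) * ∑ f ∈ KH, ProdWeight.gPiv K A q f := by
        rw [← Finset.mul_sum]
        ring

/-- **Russo's formula along the segment `s ↦ (p + C s, t - s)`**: the derivative of
`gTheta K A q(p + C s, t - s)` is `-Σ_{e ∈ KV} Piv_e + C Σ_{f ∈ KH} Piv_f`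
(`ProdWeight.hasDerivAt_gTheta`, the frozen coordinates do not contribute). [folklore] -/
theorem hasDerivAt_line {K KV KH : Finset ι} {A : Set (Set ι)} (hA : IsUpperSet A)
    (hKV : KV ⊆ K) (hKH : KH ⊆ K) (hdisj : Disjoint KV KH) (p t C s : ℝ) :
    HasDerivAt (fun s => ProdWeight.gTheta K A
        (fun i => if i ∈ KV then t - s else if i ∈ KH then p + C * s else 0))
      (-(∑ e ∈ KV, ProdWeight.gPiv K A
          (fun i => if i ∈ KV then t - s else if i ∈ KH then p + C * s else 0) e) +
        C * ∑ f ∈ KH, ProdWeight.gPiv K A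
          (fun i => if i ∈ KV then t - s else if i ∈ KH then p + C * s else 0) f) s := by
  set Q : ℝ → ι → ℝ := fun s i => if i ∈ KV then t - s else if i ∈ KH then p + C * s else 0
    with hQ
  have hq : ∀ i ∈ K, HasDerivAt (fun s => Q s i)
      (if i ∈ KV then -1 else if i ∈ KH then C else 0) s := by
    intro i _
    by_cases hiV : i ∈ KV
    · simp only [hQ, hiV, if_true]
      have := (hasDerivAt_id s).const_sub t
      simpa using this
    · by_cases hiH : i ∈ KH
      · simp only [hQ, hiV, hiH, if_false, if_true]
        have := ((hasDerivAt_id s).const_mul C).const_add p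
        simpa using this
      · simp only [hQ, hiV, hiH, if_false]
        exact hasDerivAt_const s 0
  have h := ProdWeight.hasDerivAt_gTheta hA K hq
  refine h.congr_deriv ?_
  have hpt : ∀ i ∈ K, (if i ∈ KV then -1 else if i ∈ KH then C else 0) *
      ProdWeight.gPiv K A (Q s) i =
      (if i ∈ KV then -ProdWeight.gPiv K A (Q s) i else 0) +
        (if i ∈ KH then C * ProdWeight.gPiv K A (Q s) i else 0) := by
    intro i _
    by_cases hiV : i ∈ KV
    · have hiH : i ∉ KH := Finset.disjoint_left.1 hdisj hiV
      simp [hiV, hiH]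
    · by_cases hiH : i ∈ KH
      · simp [hiV, hiH]
      · simp [hiV, hiH]
  rw [Finset.sum_congr rfl hpt, Finset.sum_add_distrib, Finset.sum_ite_mem, Finset.sum_ite_mem,
    Finset.inter_eq_right.2 hKV, Finset.inter_eq_right.2 hKH, Finset.sum_neg_distrib,
    ← Finset.mul_sum]

/-- **Integration along the segment** (Martineau–Severo 2019, §6, "`t ↦ θ_L(𝐩(t), 𝐬(t))` is
non-decreasing"; port of `AGLine.theta_line_mono`): under the local modification hypothesis with
windows `≤ N` and overlap `≤ N`, lowering the `KV`-parameter by `h` is compensated by raising the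
`KH`-parameter by `C h`, `C = μ₀^{-N} 2^N N`, as long as all parameters stay in `[μ₀, 1 - μ₀]`.
[folklore] -/
theorem line_mono {K KV KH : Finset ι} {A : Set (Set ι)} {Cw : ι → Finset ι} {N : ℕ} {μ₀ : ℝ}
    (hA : IsUpperSet A) (hKV : KV ⊆ K) (hKH : KH ⊆ K) (hdisj : Disjoint KV KH)
    (hcard : ∀ e ∈ KV, (Cw e).card ≤ N)
    (hover : ∀ f ∈ KH, (KV.filter fun e => f ∈ Cw e).card ≤ N)
    (hmod : ∀ e ∈ KV, ∀ S : Finset ι, S ⊆ KV ∪ KH → IsPivotal A e (↑S : Set ι) →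
      ∃ S' : Finset ι, S' ⊆ KV ∪ KH ∧ (∃ f ∈ KH, f ∈ Cw e ∧ IsPivotal A f (↑S' : Set ι)) ∧
        ∀ i, i ∉ Cw e → (i ∈ S ↔ i ∈ S'))
    (hμ₀ : 0 < μ₀) {p t h : ℝ} (hh : 0 ≤ h) (hp : μ₀ ≤ p)
    (hp' : p + (μ₀ ^ N)⁻¹ * 2 ^ N * (N : ℝ) * h ≤ 1 - μ₀) (ht : μ₀ ≤ t - h) (ht' : t ≤ 1 - μ₀) :
    ProdWeight.gTheta K A (fun i => if i ∈ KV then t else if i ∈ KH then p else 0) ≤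
      ProdWeight.gTheta K A (fun i => if i ∈ KV then t - h
        else if i ∈ KH then p + (μ₀ ^ N)⁻¹ * 2 ^ N * (N : ℝ) * h else 0) := by
  set C : ℝ := (μ₀ ^ N)⁻¹ * 2 ^ N * (N : ℝ) with hC
  have hC0 : 0 ≤ C :=
    mul_nonneg (mul_nonneg (inv_nonneg.2 (pow_nonneg hμ₀.le _)) (by positivity)) (Nat.cast_nonneg _)
  have hμ1 : μ₀ ≤ 1 := by linarith
  set F : ℝ → ℝ := fun s => ProdWeight.gTheta K A
      (fun i => if i ∈ KV then t - s else if i ∈ KH then p + C * s else 0) with hF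
  have hderiv := fun s => hasDerivAt_line hA hKV hKH hdisj p t C s
  have hmono : MonotoneOn F (Set.Icc 0 h) := by
    refine monotoneOn_of_hasDerivWithinAt_nonneg (convex_Icc 0 h)
      (fun s _ => (hderiv s).continuousAt.continuousWithinAt)
      (fun s _ => (hderiv s).hasDerivWithinAt) fun s hs => ?_
    rw [interior_Icc] at hs
    have hCs : 0 ≤ C * s := mul_nonneg hC0 hs.1.le
    have hCsh : C * s ≤ C * h := mul_le_mul_of_nonneg_left hs.2.le hC0
    set Qs : ι → ℝ := fun i => if i ∈ KV then t - s else if i ∈ KH then p + C * s else 0 with hQs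
    have hq : ∀ i, 0 ≤ Qs i ∧ Qs i ≤ 1 := by
      intro i
      simp only [hQs]
      split_ifs
      · constructor <;> linarith [hs.1, hs.2]
      · constructor <;> linarith
      · exact ⟨le_rfl, zero_le_one⟩
    have hqL : ∀ i ∈ KV ∪ KH, μ₀ ≤ Qs i ∧ Qs i ≤ 1 - μ₀ := by
      intro i hi
      simp only [hQs]
      rcases Finset.mem_union.1 hi with hiV | hiH
      · rw [if_pos hiV]
        constructor <;> linarith [hs.1, hs.2]
      · rw [if_neg (Finset.disjoint_right.1 hdisj hiH), if_pos hiH]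
        constructor <;> linarith
    have hq0 : ∀ i ∈ K, i ∉ KV ∪ KH → Qs i = 0 := by
      intro i _ hi
      rw [Finset.mem_union, not_or] at hi
      simp only [hQs]
      rw [if_neg hi.1, if_neg hi.2]
    have hAG : ∑ e ∈ KV, ProdWeight.gPiv K A Qs e ≤ C * ∑ f ∈ KH, ProdWeight.gPiv K A Qs f :=
      sum_piv_V_le hKV hKH hcard hover hmod hμ₀ hμ1 hq hqL hq0
    linarith
  have hle := hmono (Set.left_mem_Icc.2 hh) (Set.right_mem_Icc.2 hh) hh
  simp only [hF, sub_zero, mul_zero, add_zero] at hle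
  exact hle

end TwoClassShear

/-- **stub `stub_twoClassShear` (registered) — the abstract two-class Aizenman–Grimmett shear.**
On a finite coordinate set `K` with disjoint classes `KV` (parameter `t`) and `KH` (parameter `p`),
the rest of `K` frozen at `0`, for an increasing event `A`: a local modification turning
pivotality of any `e ∈ KV` into pivotality of some `f ∈ KH ∩ Cw e` (windows `|Cw e| ≤ N`, overlap
`≤ N`) gives `gTheta(q(p, t)) ≤ gTheta(q(p + C h, t - h))`, `C = μ₀^{-N} 2^N N`, on
`[μ₀, 1 - μ₀]` (finite energy · bounded fibres · overlap · Russo along the segment;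
`TwoClassShear.line_mono`). [folklore] -/
theorem stub_twoClassShear :
    ∀ (ι : Type) [DecidableEq ι] (K KV KH : Finset ι) (A : Set (Set ι)) (Cw : ι → Finset ι)
      (N : ℕ) (μ₀ : ℝ),
      IsUpperSet A → KV ⊆ K → KH ⊆ K → Disjoint KV KH →
      (∀ e ∈ KV, (Cw e).card ≤ N) →
      (∀ f ∈ KH, (KV.filter fun e => f ∈ Cw e).card ≤ N) →
      (∀ e ∈ KV, ∀ S : Finset ι, S ⊆ KV ∪ KH → IsPivotal A e (↑S : Set ι) →
        ∃ S' : Finset ι, S' ⊆ KV ∪ KH ∧ (∃ f ∈ KH, f ∈ Cw e ∧ IsPivotal A f (↑S' : Set ι)) ∧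
          ∀ i, i ∉ Cw e → (i ∈ S ↔ i ∈ S')) →
      0 < μ₀ → μ₀ ≤ 1 / 2 →
      ∀ p t h : ℝ, 0 ≤ h → μ₀ ≤ p → p + (μ₀ ^ N)⁻¹ * 2 ^ N * (N : ℝ) * h ≤ 1 - μ₀ →
        μ₀ ≤ t - h → t ≤ 1 - μ₀ →
        ProdWeight.gTheta K A (fun i => if i ∈ KV then t else if i ∈ KH then p else 0) ≤
          ProdWeight.gTheta K A (fun i => if i ∈ KV then t - h
            else if i ∈ KH then p + (μ₀ ^ N)⁻¹ * 2 ^ N * (N : ℝ) * h else 0) := by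
  intro ι _ K KV KH A Cw N μ₀ hA hKV hKH hdisj hcard hover hmod hμ₀ _ p t h hh hp hp' ht ht'
  exact TwoClassShear.line_mono hA hKV hKH hdisj hcard hover hmod hμ₀ hh hp hp' ht ht'

end Summit.CriticalPhenomena.PercolationContinuityZ3.Cruxes.CriticalCurveRegular.Locmod

end
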